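import Summits.Ventures.YMGap.RobustBall.LocalSourceScreeningStar
import Summits.Ventures.YMGap.RobustBall.RobustStarDoorZdVariance
import Literature.Probability.LatticeModels.DobrushinShlosmanSuperSolutionStates
import HarnessLib

/-!
# Venture YMGap, track ROBUST-BALL (Y2) — LOCAL SOURCES ARE SCREENED THROUGH THE STAR DOOR AT THE GEOMETRIC RATE

HONEST FRAMING. WHAT THIS IS: a venture file (cell `pub-ymgap`, track Y2 ROBUST-BALL, seat rb-p1, theorems only). The screening
theorem of `LocalSourceScreeningStar.lean` (member with a star window bound `StarWindowBoundZdR … D ρ`; source `V` = ANY bounded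
adapted modification whose terms read only the links of a finite `S`; every DLR `μ` of `W`, EVERY DLR `ν` of `W + V`) re-run through
the super-solution form of the Dobrushin–Shlosman comparison (Literature `DobrushinShlosmanSuperSolutionStates`,
`abs_integral_sub_integral_le_of_window_pair_geometric` — this seat), which the PER-STAR received sum of the door affords:

  `|∫ f dμ − ∫ f dν| ≤ 2√N · ρ^{⌊d(Δ,S)/(D+2)⌋} · Σ_{y ∈ Δ} δ_y`      (`abs_integral_sub_integral_le_of_source_star_geometric`),

exponential reading `≤ 4√N · e^{−(log(1/max(ρ,½))/(D+2)) d(Δ,S)} · Σ δ` (`…_exp`, `…_cylinder`), and the BALL forms through ds-2's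
robust star door, modulus and variance versions (`localScreeningStar_of_memBallZdG_geometric[_variance]`: rate
`log(1/max(ρ₀,½))/(max R 1 + 4)`, constant `4√N`) — compare `LocalSourceScreeningStar.lean`: rate `starRate d ρ₀/(max R 1 + 4)`,
constant `8√N`. WHAT THIS IS NOT: a one-sided comparison rate; the constant is strength-free (the linear response is the defect
form, separate file); lattice strong coupling only, nothing about the continuum limit or a Clay-sense mass gap.
-/

noncomputable section

open MeasureTheory ProbabilityTheory Function Finset Real
open scoped NNReal
open Literature.Probability.LatticeModels
open Literature.Probability.LatticeModels.DobrushinMetric (IsLipBound)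
open Literature.MathematicalPhysics.QuantumLattice
open Literature.MathematicalPhysics.QuantumFieldTheory hiding ZdEdge Site
open Literature.MathematicalPhysics.QuantumFieldTheory.Balaban1983to89.StrongCouplingDobrushinWindow
  (OneLinkKRModulus)
open Summit.QuantumFields.BalabanUV.InfraRed.StrongCouplingPoincareDoorSUN (OneLinkPoincareSUN)
open Summit.QuantumFields.BalabanUV.InfraRed.StrongCouplingVarianceDoorSUN (OneLinkVarianceBound)
open Summit.Ventures.YMGap.DSWindowZd
open Summit.Ventures.YMGap.StarResolventDim (Delta gaugeR doorPoly gaugeR_lt_one_of_door)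

namespace Summit.Ventures.YMGap.RobustBall

variable {d N : ℕ}

/-! ## §1 The generic member: geometric rate -/

/-- **LOCAL SOURCES ARE SCREENED THROUGH THE STAR DOOR — GEOMETRIC RATE, floor form.** Hypotheses of
`abs_integral_sub_integral_le_of_source_star`. Conclusion: `|∫ f dμ − ∫ f dν| ≤ 2√N · ρ^{⌊d(Δ,S)/(D+2)⌋} · Σ_{y ∈ Δ} δ y`
(Literature `abs_integral_sub_integral_le_of_window_pair_geometric`, usable stars = those avoiding `S`, where the kernels coincide
by `perturbedYM_add_eq_of_dependsOn_compl`; ds-2's profile `exists_starProfileR … Δ S`). -/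
theorem abs_integral_sub_integral_le_of_source_star_geometric {β ρ : ℝ} {R D : ℕ}
    {W : Potential (ZdEdge d) (SUN N)} (hWc : ∀ X, Continuous (W X))
    (hWdep : ∀ X, DependsOn (W X) (↑X : Set (ZdEdge d)))
    {supp : Finset (ZdEdge d) → Finset (Finset (ZdEdge d))} (hsupp : W.IsSupportedBy supp)
    (hR : ∀ e, ∀ X ∈ supp {e}, e ∈ X → ∀ y ∈ X, ‖e.1 - y.1‖ ≤ (R : ℝ)) (hD : R + 2 ≤ D)
    (hρ0 : 0 ≤ ρ) (hρ1 : ρ < 1)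
    (h : StarWindowBoundZdR d N (perturbedYM (d := d) (fundamentalRep (Fin N)) (N * β) W supp) D ρ
      suFrobDist)
    {V : Potential (ZdEdge d) (SUN N)} (hV : V.IsAdapted) (hVb : ∀ X, ∃ C, ∀ U, |V X U| ≤ C)
    {suppV : Finset (ZdEdge d) → Finset (Finset (ZdEdge d))} (hsuppV : V.IsSupportedBy suppV)
    {S : Finset (ZdEdge d)} (hVS : ∀ X, DependsOn (V X) (↑S : Set (ZdEdge d)))
    {μ ν : Measure (LGConfig d (SUN N))}
    (hμ : μ ∈ perturbedGibbsMeasures (d := d) (fundamentalRep (Fin N)) (N * β) W supp)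
    (hν : ν ∈ perturbedGibbsMeasures (d := d) (fundamentalRep (Fin N)) (N * β) (W + V)
      (fun Λ => supp Λ ∪ suppV Λ))
    {f : LGConfig d (SUN N) → ℝ} (hfm : Measurable f) {Bf : ℝ} (hBf : ∀ σ, |f σ| ≤ Bf)
    {Δ : Finset (ZdEdge d)} (hfdep : DependsOn f (↑Δ : Set (ZdEdge d)))
    {δ : ZdEdge d → ℝ} (hδ : IsLipBound suFrobDist f δ) :
    |(∫ σ, f σ ∂μ) - ∫ σ, f σ ∂ν| ≤ 2 * Real.sqrt N * ρ ^ ⌊setDistEdges Δ S / (D + 2 : ℕ)⌋₊ * ∑ y ∈ Δ, δ y := by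
  -- adapted from `abs_integral_sub_integral_le_of_source_star` (geometric comparison instead of the three-zone one)
  classical
  haveI : SecondCountableTopology (Matrix (Fin N) (Fin N) ℂ) :=
    inferInstanceAs (SecondCountableTopology (Fin N → Fin N → ℂ))
  haveI : SecondCountableTopology (SUN N) := Topology.IsEmbedding.subtypeVal.secondCountableTopology
  have hW : W.IsAdapted := fun X => ⟨hWdep X, (hWc X).measurable⟩
  have hWb : ∀ X, ∃ C, ∀ U, |W X U| ≤ C := fun X => exists_bound_of_continuous (hWc X)
  have hWV : (W + V).IsAdapted := isAdapted_add hW hV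
  have hWVb : ∀ X, ∃ C, ∀ U, |(W + V) X U| ≤ C := fun X => by
    obtain ⟨C₁, h₁⟩ := hWb X; obtain ⟨C₂, h₂⟩ := hVb X
    exact ⟨C₁ + C₂, fun U => (abs_add_le _ _).trans (add_le_add (h₁ U) (h₂ U))⟩
  have hγ : IsSpecification (perturbedYM (d := d) (fundamentalRep (Fin N)) (N * β) W supp) :=
    isSpecification_perturbedYM _ (continuous_fundamentalRep (Fin N)) _ hW hWb hsupp
  have hγ' : IsSpecification (perturbedYM (d := d) (fundamentalRep (Fin N)) (N * β) (W + V)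
      (fun Λ => supp Λ ∪ suppV Λ)) :=
    isSpecification_perturbedYM _ (continuous_fundamentalRep (Fin N)) _ hWV hWVb (isSupportedBy_add_union hsupp hsuppV)
  have hμ' : IsGibbsMeasure (perturbedYM (d := d) (fundamentalRep (Fin N)) (N * β) W supp) μ := hμ
  have hν' : IsGibbsMeasure (perturbedYM (d := d) (fundamentalRep (Fin N)) (N * β) (W + V)
      (fun Λ => supp Λ ∪ suppV Λ)) ν := hν
  have hD1 : 1 ≤ D := by omega
  have hloc : ∀ (c : ZdEdge d) (ζ ζ' : LGConfig d (SUN N)), (∀ v ∈ starNbhdZdR D c.1, ζ v = ζ' v) →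
      ∀ (g : LGConfig d (SUN N) → ℝ), Measurable g → (∃ B, ∀ σ, |g σ| ≤ B) →
        DependsOn g (starWinZd c : Set (ZdEdge d)) →
        ∫ σ, g σ ∂(perturbedYM (d := d) (fundamentalRep (Fin N)) (N * β) W supp (starWinZd c) ζ) =
          ∫ σ, g σ ∂(perturbedYM (d := d) (fundamentalRep (Fin N)) (N * β) W supp (starWinZd c) ζ') :=
    fun c ζ ζ' hζ g hgm _ hgdep => perturbed_star_hloc _ (continuous_fundamentalRep (Fin N)) _
      (fun X => (hWc X).measurable) hWdep hsupp hR hD c ζ ζ' hζ g hgm hgdep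
  have hagree : ∀ c : ZdEdge d, (∀ z ∈ starWinZd c, z ∉ S) → ∀ (σ : LGConfig d (SUN N))
      ⦃g : LGConfig d (SUN N) → ℝ⦄, Measurable g → (∃ B, ∀ τ, |g τ| ≤ B) →
      ∫ τ, g τ ∂(perturbedYM (d := d) (fundamentalRep (Fin N)) (N * β) (W + V) (fun Λ => supp Λ ∪ suppV Λ)
          (starWinZd c) σ) =
        ∫ τ, g τ ∂(perturbedYM (d := d) (fundamentalRep (Fin N)) (N * β) W supp (starWinZd c) σ) := by
    intro c hc σ g _ _
    have hoff : ∀ A, DependsOn (V A) ((↑(starWinZd c) : Set (ZdEdge d))ᶜ) := fun A =>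
      (hVS A).mono fun e heS heW => hc e (Finset.mem_coe.1 heW) (Finset.mem_coe.1 heS)
    rw [perturbedYM_add_eq_of_dependsOn_compl (fundamentalRep (Fin N)) (N * β) hsupp hsuppV
      (fun A => (hV A).2) (starWinZd c) hoff σ]
  obtain ⟨K, hK0, hKsupp, hcontract, hsum⟩ := h
  have hR₀ : (0 : ℝ) ≤ 2 * Real.sqrt N := by positivity
  obtain ⟨Λ, ℓ, hΔΛ, hU, hℓ, hL⟩ := exists_starProfileR hD1 K hKsupp Δ S
  exact DobrushinShlosman.abs_integral_sub_integral_le_of_window_pair_geometric hγ hγ' suFrobDist_nonneg suFrobDist_le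
    hR₀ (win := starWinZd) (nbhd := fun c => starNbhdZdR D c.1) (K := fun c => K c.1) (fun c y x => hK0 _ _ _)
    self_mem_starWinZd (fun c => vertexStarZd_subset_starNbhdZdR hD1 c.1) (fun c y x => hKsupp _ _ _)
    hcontract hloc hρ0 hρ1 (fun c x hx => hsum c.1 x hx) hμ' hν' (fun c => ∀ z ∈ starWinZd c, z ∉ S) hagree hfm
    hBf hfdep hδ Λ hΔΛ ℓ _ hU hℓ hL

/-- **Exponential reading, GEOMETRIC RATE**: with `ρ' = max(ρ,½)` (`ρ'^{⌊x⌋} ≤ 2 e^{−log(1/ρ') x}`):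
`|∫ f dμ − ∫ f dν| ≤ 4√N · e^{−(log(1/max(ρ,½))/(D+2)) · d(Δ,S)} · Σ_{y ∈ Δ} δ y`. -/
theorem abs_integral_sub_integral_le_of_source_star_geometric_exp {β ρ : ℝ} {R D : ℕ}
    {W : Potential (ZdEdge d) (SUN N)} (hWc : ∀ X, Continuous (W X))
    (hWdep : ∀ X, DependsOn (W X) (↑X : Set (ZdEdge d)))
    {supp : Finset (ZdEdge d) → Finset (Finset (ZdEdge d))} (hsupp : W.IsSupportedBy supp)
    (hR : ∀ e, ∀ X ∈ supp {e}, e ∈ X → ∀ y ∈ X, ‖e.1 - y.1‖ ≤ (R : ℝ)) (hD : R + 2 ≤ D) (hρ1 : ρ < 1)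
    (h : StarWindowBoundZdR d N (perturbedYM (d := d) (fundamentalRep (Fin N)) (N * β) W supp) D ρ
      suFrobDist)
    {V : Potential (ZdEdge d) (SUN N)} (hV : V.IsAdapted) (hVb : ∀ X, ∃ C, ∀ U, |V X U| ≤ C)
    {suppV : Finset (ZdEdge d) → Finset (Finset (ZdEdge d))} (hsuppV : V.IsSupportedBy suppV)
    {S : Finset (ZdEdge d)} (hVS : ∀ X, DependsOn (V X) (↑S : Set (ZdEdge d)))
    {μ ν : Measure (LGConfig d (SUN N))}
    (hμ : μ ∈ perturbedGibbsMeasures (d := d) (fundamentalRep (Fin N)) (N * β) W supp)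
    (hν : ν ∈ perturbedGibbsMeasures (d := d) (fundamentalRep (Fin N)) (N * β) (W + V)
      (fun Λ => supp Λ ∪ suppV Λ))
    {f : LGConfig d (SUN N) → ℝ} (hfm : Measurable f) {Bf : ℝ} (hBf : ∀ σ, |f σ| ≤ Bf)
    {Δ : Finset (ZdEdge d)} (hfdep : DependsOn f (↑Δ : Set (ZdEdge d)))
    {δ : ZdEdge d → ℝ} (hδ : IsLipBound suFrobDist f δ) :
    |(∫ σ, f σ ∂μ) - ∫ σ, f σ ∂ν| ≤ 4 * Real.sqrt N *
      Real.exp (-(-Real.log (max ρ (1 / 2)) / (D + 2 : ℕ)) * setDistEdges Δ S) * ∑ y ∈ Δ, δ y := by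
  set ρ' : ℝ := max ρ (1 / 2) with hρ'
  have hρ'h : 1 / 2 ≤ ρ' := le_max_right _ _
  have hρ'0 : 0 < ρ' := lt_of_lt_of_le (by norm_num) hρ'h
  have hρ'1 : ρ' < 1 := max_lt hρ1 (by norm_num)
  have key := abs_integral_sub_integral_le_of_source_star_geometric hWc hWdep hsupp hR hD hρ'0.le hρ'1
    (h.mono_rho (le_max_left _ _)) hV hVb hsuppV hVS hμ hν hfm hBf hfdep hδ
  set κ : ℝ := -Real.log ρ' with hκ
  have hκ0 : 0 ≤ κ := by rw [hκ, neg_nonneg]; exact Real.log_nonpos hρ'0.le hρ'1.le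
  have hD2 : (0 : ℝ) < ((D + 2 : ℕ) : ℝ) := by positivity
  have hpow : ρ' ^ ⌊setDistEdges Δ S / (D + 2 : ℕ)⌋₊ = Real.exp (-(κ * ⌊setDistEdges Δ S / (D + 2 : ℕ)⌋₊)) := by
    rw [hκ, neg_mul, neg_neg, mul_comm, Real.exp_nat_mul, Real.exp_log hρ'0]
  have hgeom : Real.exp (-(κ * ⌊setDistEdges Δ S / (D + 2 : ℕ)⌋₊)) ≤
      Real.exp κ * Real.exp (-(κ / (D + 2 : ℕ)) * setDistEdges Δ S) := by
    rw [← Real.exp_add]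
    refine Real.exp_le_exp.2 ?_
    have hfl : setDistEdges Δ S / (D + 2 : ℕ) - 1 ≤ (⌊setDistEdges Δ S / (D + 2 : ℕ)⌋₊ : ℝ) := by
      have := Nat.lt_floor_add_one (setDistEdges Δ S / (D + 2 : ℕ))
      linarith
    have := mul_le_mul_of_nonneg_left hfl hκ0
    have e1 : -(κ / (D + 2 : ℕ)) * setDistEdges Δ S = -(κ * (setDistEdges Δ S / (D + 2 : ℕ))) := by
      field_simp
    rw [e1]
    linarith
  have hexpκ : Real.exp κ ≤ 2 := by
    rw [hκ, Real.exp_neg, Real.exp_log hρ'0, inv_le_comm₀ hρ'0 (by norm_num : (0:ℝ) < 2)]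
    linarith
  have hsum0 : 0 ≤ ∑ y ∈ Δ, δ y := Finset.sum_nonneg fun y _ => hδ.nonneg y
  have hsq : 0 ≤ Real.sqrt N := Real.sqrt_nonneg _
  calc |(∫ σ, f σ ∂μ) - ∫ σ, f σ ∂ν| ≤ 2 * Real.sqrt N * ρ' ^ ⌊setDistEdges Δ S / (D + 2 : ℕ)⌋₊ * ∑ y ∈ Δ, δ y := key
    _ = 2 * Real.sqrt N * Real.exp (-(κ * ⌊setDistEdges Δ S / (D + 2 : ℕ)⌋₊)) * ∑ y ∈ Δ, δ y := by rw [hpow]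
    _ ≤ 2 * Real.sqrt N * (Real.exp κ * Real.exp (-(κ / (D + 2 : ℕ)) * setDistEdges Δ S)) * ∑ y ∈ Δ, δ y := by
        gcongr
    _ ≤ 2 * Real.sqrt N * (2 * Real.exp (-(κ / (D + 2 : ℕ)) * setDistEdges Δ S)) * ∑ y ∈ Δ, δ y := by gcongr
    _ = 4 * Real.sqrt N * Real.exp (-(κ / (D + 2 : ℕ)) * setDistEdges Δ S) * ∑ y ∈ Δ, δ y := by ring

/-- **Lipschitz-cylinder reading, GEOMETRIC RATE** (`Σ δ = #Λ_F · K_F`):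
`|∫ F dμ − ∫ F dν| ≤ 4√N · e^{−(log(1/max(ρ,½))/(D+2)) · d(Λ,S)} · #Λ · K_F`. -/
theorem abs_integral_sub_integral_le_of_source_star_geometric_cylinder {β ρ : ℝ} {R D : ℕ}
    {W : Potential (ZdEdge d) (SUN N)} (hWc : ∀ X, Continuous (W X))
    (hWdep : ∀ X, DependsOn (W X) (↑X : Set (ZdEdge d)))
    {supp : Finset (ZdEdge d) → Finset (Finset (ZdEdge d))} (hsupp : W.IsSupportedBy supp)
    (hR : ∀ e, ∀ X ∈ supp {e}, e ∈ X → ∀ y ∈ X, ‖e.1 - y.1‖ ≤ (R : ℝ)) (hD : R + 2 ≤ D) (hρ1 : ρ < 1)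
    (h : StarWindowBoundZdR d N (perturbedYM (d := d) (fundamentalRep (Fin N)) (N * β) W supp) D ρ
      suFrobDist)
    {V : Potential (ZdEdge d) (SUN N)} (hV : V.IsAdapted) (hVb : ∀ X, ∃ C, ∀ U, |V X U| ≤ C)
    {suppV : Finset (ZdEdge d) → Finset (Finset (ZdEdge d))} (hsuppV : V.IsSupportedBy suppV)
    {S : Finset (ZdEdge d)} (hVS : ∀ X, DependsOn (V X) (↑S : Set (ZdEdge d)))
    {μ ν : Measure (LGConfig d (SUN N))}
    (hμ : μ ∈ perturbedGibbsMeasures (d := d) (fundamentalRep (Fin N)) (N * β) W supp)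
    (hν : ν ∈ perturbedGibbsMeasures (d := d) (fundamentalRep (Fin N)) (N * β) (W + V)
      (fun Λ => supp Λ ∪ suppV Λ))
    {F : LGConfig d (SUN N) → ℝ} {Λ : Finset (ZdEdge d)} {KF : ℝ≥0}
    (hF : IsLipschitzCylinder (fundamentalRep (Fin N)) F Λ KF) :
    |(∫ σ, F σ ∂μ) - ∫ σ, F σ ∂ν| ≤ 4 * Real.sqrt N *
      Real.exp (-(-Real.log (max ρ (1 / 2)) / (D + 2 : ℕ)) * setDistEdges Λ S) * (Λ.card * KF) := by
  classical
  have hA : ∀ a b : SUN N, dist (suEntries a) (suEntries b) ≤ 1 * suFrobDist a b :=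
    fun a b => by rw [one_mul]; exact dist_suEntries_le_suFrobDist a b
  have key := abs_integral_sub_integral_le_of_source_star_geometric_exp hWc hWdep hsupp hR hD hρ1 h hV hVb hsuppV hVS hμ hν
    hF.measurable hF.abs_le hF.dependsOn (hF.isLipBound zero_le_one hA)
  have hsum : ∑ y ∈ Λ, (if y ∈ Λ then (1 : ℝ) * (KF : ℝ) else 0) = Λ.card * KF := by
    rw [Finset.sum_ite_of_true (fun y hy => hy), Finset.sum_const, nsmul_eq_mul, one_mul]
  rw [hsum] at key
  exact key

/-! ## §2 The ball through the robust star door (modulus and variance forms), geometric rate -/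

/-- **LOCAL SOURCES ARE SCREENED UNIFORMLY ON THE GAUGE-INVARIANT TIER-1 BALL — GEOMETRIC RATE** (hypotheses of ds-2's
`massGapOnBallZdG_of_robustStar`, `ρ ≤ ρ₀ < 1`): for every member of `MemBallZdG ε₀ ε₁ R`, every bounded adapted source reading
only the links of a finite `S`, every DLR pair and every Lipschitz cylinder `F`:
`|∫ F dμ − ∫ F dν| ≤ 4√N · e^{−(log(1/max(ρ₀,½))/(max R 1 + 4)) · d(Λ_F,S)} · #Λ_F · K_F`. -/
theorem localScreeningStar_of_memBallZdG_geometric (hd : 2 ≤ d) (hN : 1 ≤ N) {β ε₀ ε₁ Rm K c lam θ ρ ρ₀ : ℝ}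
    {R Kn : ℕ} (hK : 0 ≤ K) (hRm : |(N : ℝ) * β| / N * (2 * ((d : ℝ) - 1)) ≤ Rm) (hmod : OneLinkKRModulus N Rm K)
    (hε₁ : 0 ≤ ε₁) (hc : K * Real.exp ε₀ * (1 + 2 * Real.sqrt N * ε₁) * (|(N : ℝ) * β| / N) ≤ c)
    (hlam : Real.sqrt N * ε₁ ≤ lam) (hθ : θ = (2 * (d : ℝ) - 2) * c + lam) (hθ1 : θ < 1)
    (hcd : doorPoly d c < 1) (hρ : ρ = gaugeR d c + (lam + θ ^ Kn * (4 * d * lam)) / (1 - θ)) (hρle : ρ ≤ ρ₀)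
    (hρ1 : ρ₀ < 1)
    {W : Potential (ZdEdge d) (SUN N)} {supp : Finset (ZdEdge d) → Finset (Finset (ZdEdge d))}
    (hW : MemBallZdG ε₀ ε₁ R W supp)
    {V : Potential (ZdEdge d) (SUN N)} (hV : V.IsAdapted) (hVb : ∀ X, ∃ C, ∀ U, |V X U| ≤ C)
    {suppV : Finset (ZdEdge d) → Finset (Finset (ZdEdge d))} (hsuppV : V.IsSupportedBy suppV)
    {S : Finset (ZdEdge d)} (hVS : ∀ X, DependsOn (V X) (↑S : Set (ZdEdge d)))
    {μ ν : Measure (LGConfig d (SUN N))}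
    (hμ : μ ∈ perturbedGibbsMeasures (d := d) (fundamentalRep (Fin N)) (N * β) W supp)
    (hν : ν ∈ perturbedGibbsMeasures (d := d) (fundamentalRep (Fin N)) (N * β) (W + V)
      (fun Λ => supp Λ ∪ suppV Λ))
    {F : LGConfig d (SUN N) → ℝ} {Λ : Finset (ZdEdge d)} {KF : ℝ≥0}
    (hF : IsLipschitzCylinder (fundamentalRep (Fin N)) F Λ KF) :
    |(∫ σ, F σ ∂μ) - ∫ σ, F σ ∂ν| ≤ 4 * Real.sqrt N *
      Real.exp (-(-Real.log (max ρ₀ (1 / 2)) / (max R 1 + 4 : ℕ)) * setDistEdges Λ S) * (Λ.card * KF) := by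
  have hwin := (starWindowBoundZdR_of_memBallZdG hd hN hK hRm hmod hε₁ hc hlam hθ hθ1 hcd hρ hW).mono_rho hρle
  have hD : R + 2 ≤ max R 1 + 2 := by omega
  have key := abs_integral_sub_integral_le_of_source_star_geometric_cylinder hW.continuous hW.dependsOn hW.supportedBy
    hW.range hD hρ1 hwin hV hVb hsuppV hVS hμ hν hF
  have e4 : (max R 1 + 2 + 2 : ℕ) = max R 1 + 4 := by omega
  rw [e4] at key
  exact key

/-- **THE SAME THROUGH THE VARIANCE-FORM ROBUST STAR DOOR** (hypotheses of `massGapOnBallZdG_of_robustStar_variance`,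
`ρ ≤ ρ₀ < 1`). -/
theorem localScreeningStar_of_memBallZdG_variance_geometric (hd : 2 ≤ d) (hN : 1 ≤ N)
    {β ε₀ ε₁ b cP v c lam θ ρ ρ₀ : ℝ} {R Kn : ℕ} (hcP : 0 ≤ cP) (hv : 0 ≤ v)
    (hb : |(N : ℝ) * β| / N * (2 * ((d : ℝ) - 1)) ≤ b) (hP : OneLinkPoincareSUN N b cP)
    (hVB : OneLinkVarianceBound N b v) (hε₁ : 0 ≤ ε₁) (hc : Real.exp ε₀ * Real.sqrt (cP * v) * (|(N : ℝ) * β| / N) ≤ c)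
    (hlam : Real.exp (ε₀ / 2) * Real.sqrt cP * ε₁ ≤ lam) (hθ : θ = (2 * (d : ℝ) - 2) * c + lam) (hθ1 : θ < 1)
    (hcd : doorPoly d c < 1) (hρ : ρ = gaugeR d c + (lam + θ ^ Kn * (4 * d * lam)) / (1 - θ)) (hρle : ρ ≤ ρ₀)
    (hρ1 : ρ₀ < 1)
    {W : Potential (ZdEdge d) (SUN N)} {supp : Finset (ZdEdge d) → Finset (Finset (ZdEdge d))}
    (hW : MemBallZdG ε₀ ε₁ R W supp)
    {V : Potential (ZdEdge d) (SUN N)} (hV : V.IsAdapted) (hVb : ∀ X, ∃ C, ∀ U, |V X U| ≤ C)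
    {suppV : Finset (ZdEdge d) → Finset (Finset (ZdEdge d))} (hsuppV : V.IsSupportedBy suppV)
    {S : Finset (ZdEdge d)} (hVS : ∀ X, DependsOn (V X) (↑S : Set (ZdEdge d)))
    {μ ν : Measure (LGConfig d (SUN N))}
    (hμ : μ ∈ perturbedGibbsMeasures (d := d) (fundamentalRep (Fin N)) (N * β) W supp)
    (hν : ν ∈ perturbedGibbsMeasures (d := d) (fundamentalRep (Fin N)) (N * β) (W + V)
      (fun Λ => supp Λ ∪ suppV Λ))
    {F : LGConfig d (SUN N) → ℝ} {Λ : Finset (ZdEdge d)} {KF : ℝ≥0}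
    (hF : IsLipschitzCylinder (fundamentalRep (Fin N)) F Λ KF) :
    |(∫ σ, F σ ∂μ) - ∫ σ, F σ ∂ν| ≤ 4 * Real.sqrt N *
      Real.exp (-(-Real.log (max ρ₀ (1 / 2)) / (max R 1 + 4 : ℕ)) * setDistEdges Λ S) * (Λ.card * KF) := by
  have hwin := (starWindowBoundZdR_of_memBallZdG_variance hd hN hcP hv hb hP hVB hε₁ hc hlam hθ hθ1 hcd hρ hW).mono_rho
    hρle
  have hD : R + 2 ≤ max R 1 + 2 := by omega
  have key := abs_integral_sub_integral_le_of_source_star_geometric_cylinder hW.continuous hW.dependsOn hW.supportedBy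
    hW.range hD hρ1 hwin hV hVb hsuppV hVS hμ hν hF
  have e4 : (max R 1 + 2 + 2 : ℕ) = max R 1 + 4 := by omega
  rw [e4] at key
  exact key

end Summit.Ventures.YMGap.RobustBall

end
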